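import Literature.Probability.Percolation.SahiSunflowerSeparation
import Mathlib.Tactic.Linarith
import Mathlib.Tactic.Ring
import HarnessLib

/-!
# `NoHeavyLowerTail` (crux stmt-CriticalPhenomena-4575), master-family line P1: Sahi's `E_3` on sunflower complements IS Gladkov's slack
# plus a square-minus-product — a quantitative lower bound from Gladkov's theorem and the "core-heavy" stratum

Support file (seat `prim-masterthm-p1`, gen 8; `--supports stmt-CriticalPhenomena-4575`).  No definition, no `sorry`, standard axioms.
Memo `run/shared/lean/prim/prim-masterthm/FROM-prim-masterthm-p1-g8-PRIVATE-COORDINATE.md` §0.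

For a three-petal sunflower `U₁, U₂, U₃` of events (all pairwise intersections `= A`; core `a = μ(A)`, petals `c_i = μ(U_i ∖ A)`,
`b = μ((U₁∪U₂∪U₃)ᶜ)`), the tree has `E_3(U₁ᶜ,U₂ᶜ,U₃ᶜ) = (1 + a)(ab − e₂(c)) − e₃(c)` (`sahiE3_compl_sunflower_eq`) and, for increasing `U_i`
under a product measure, Gladkov's `ab ≥ e₂(c)` (`prodBernoulli_strongHarris_sunflower_three`), whence `E_3 ≥ −e₃(c)`
(`prodBernoulli_sahiE3_compl_sunflower_ge`).  THIS FILE: the identity regroups as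
* `sahiE3_compl_sunflower_eq_gladkov_add_sq` — **`E_3(U₁ᶜ,U₂ᶜ,U₃ᶜ) = [ab − e₂(c)] + [μ(A)² − μ(U₁)μ(U₂)μ(U₃)]`** (any probability measure):
  Kahn's Conjecture 5 on sunflower complements says exactly that GLADKOV'S SLACK DOMINATES `μ(U₁)μ(U₂)μ(U₃) − μ(A)²`;
* `prodBernoulli_sahiE3_compl_sunflower_ge_sq_sub_prod` — hence, for increasing `U_i` under a product measure,
  **`E_3(U₁ᶜ,U₂ᶜ,U₃ᶜ) ≥ μ(A)² − μ(U₁)μ(U₂)μ(U₃)`** (a second Gladkov corollary; neither it nor `≥ −e₃` implies the other);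
* `prodBernoulli_sahiE3_compl_sunflower_nonneg_of_coreHeavy` — **the CORE-HEAVY STRATUM**: if `μ(U₁)μ(U₂)μ(U₃) ≤ μ(A)²` then
  `E_3(U₁ᶜ,U₂ᶜ,U₃ᶜ) ≥ 0` (Kahn's Conjecture 5 / the tree's open `(1+a)(ab−e₂) ≥ e₃` for these sunflowers; contains all near-diagonal triples,
  e.g. `U₁ = U₂ = U₃`, and is transversal to the cylinder strata of `…SahiCoSunflowerOrCoordinate/Cylinder`).
In the "pairwise-intersection" variables of the seat's memo (`U_i = F_jF_k`, `a = μ(F₁F₂F₃)`, `v_i = μ(U_i)`):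
`E = (1+a)(1+Σv_i) − Π(1+v_i) = Gladkov + a² − v₁v₂v₃`.  HONEST FRAMING: corollaries of a published theorem plus bookkeeping; the conjecture
itself remains OPEN. [this work]
-/

noncomputable section

namespace Summit.CriticalPhenomena.PercolationContinuityZ3.Theorems

namespace SahiSunflowerGladkovSquare

open MeasureTheory Literature.Probability.LatticeModels

/-! ### 1. The regrouped identity (any probability measure) -/

section General

variable {Ω : Type*} [MeasurableSpace Ω] (μ : Measure Ω) [IsProbabilityMeasure μ]
variable {U₁ U₂ U₃ A : Set Ω}

/-- **`E_3` on sunflower complements = Gladkov's slack + (core² − product of the members).**  For a probability measure and a measurable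
sunflower `U₁ ∩ U₂ = U₁ ∩ U₃ = U₂ ∩ U₃ = A`:
`E_3(U₁ᶜ,U₂ᶜ,U₃ᶜ) = [μ(A)·μ((U₁∪U₂∪U₃)ᶜ) − e₂(μ(U_i∖A))] + [μ(A)² − μ(U₁)μ(U₂)μ(U₃)]`. [this work] -/
theorem sahiE3_compl_sunflower_eq_gladkov_add_sq (h₁ : MeasurableSet U₁) (h₂ : MeasurableSet U₂) (h₃ : MeasurableSet U₃)
    (h12 : U₁ ∩ U₂ = A) (h13 : U₁ ∩ U₃ = A) (h23 : U₂ ∩ U₃ = A) :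
    sahiE3 μ U₁ᶜ U₂ᶜ U₃ᶜ =
      (μ.real A * μ.real (U₁ ∪ U₂ ∪ U₃)ᶜ -
          (μ.real (U₁ \ A) * μ.real (U₂ \ A) + μ.real (U₁ \ A) * μ.real (U₃ \ A) + μ.real (U₂ \ A) * μ.real (U₃ \ A)))
        + (μ.real A ^ 2 - μ.real U₁ * μ.real U₂ * μ.real U₃) := by
  rw [sahiE3_compl_sunflower_eq μ h₁ h₂ h₃ h12 h13 h23]
  have hA : MeasurableSet A := by rw [← h12]; exact h₁.inter h₂
  have hAU₁ : A ⊆ U₁ := by rw [← h12]; exact Set.inter_subset_left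
  have hAU₂ : A ⊆ U₂ := by rw [← h12]; exact Set.inter_subset_right
  have hAU₃ : A ⊆ U₃ := by rw [← h13]; exact Set.inter_subset_right
  have d₁ : μ.real (U₁ \ A) = μ.real U₁ - μ.real A := measureReal_sdiff hAU₁ hA
  have d₂ : μ.real (U₂ \ A) = μ.real U₂ - μ.real A := measureReal_sdiff hAU₂ hA
  have d₃ : μ.real (U₃ \ A) = μ.real U₃ - μ.real A := measureReal_sdiff hAU₃ hA
  have hb : μ.real (U₁ ∪ U₂ ∪ U₃)ᶜ = 1 - (μ.real U₁ + μ.real U₂ + μ.real U₃ - 2 * μ.real A) := by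
    rw [measureReal_compl ((h₁.union h₂).union h₃), probReal_univ,
      measureReal_union₃_of_pairwise_inter_eq μ h₂ h₃ h12 h13 h23]
  rw [d₁, d₂, d₃, hb]
  ring

end General

/-! ### 2. Product measures: the lower bound and the core-heavy stratum -/

section ProdBernoulli

variable {ι : Type*} [Finite ι]

/-- **Second Gladkov corollary.**  For `μ = prodBernoulli p` and INCREASING `U₁, U₂, U₃` with all pairwise intersections `A`:
`E_3(U₁ᶜ,U₂ᶜ,U₃ᶜ) ≥ μ(A)² − μ(U₁)μ(U₂)μ(U₃)` — Gladkov's `ab ≥ e₂` dropped from the regrouped identity. [this work] -/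
theorem prodBernoulli_sahiE3_compl_sunflower_ge_sq_sub_prod (p : ι → unitInterval) {U₁ U₂ U₃ A : Set (Set ι)}
    (hU₁ : IsUpperSet U₁) (hU₂ : IsUpperSet U₂) (hU₃ : IsUpperSet U₃) (h12 : U₁ ∩ U₂ = A) (h13 : U₁ ∩ U₃ = A)
    (h23 : U₂ ∩ U₃ = A) :
    (prodBernoulli p).real A ^ 2 - (prodBernoulli p).real U₁ * (prodBernoulli p).real U₂ * (prodBernoulli p).real U₃ ≤
      sahiE3 (prodBernoulli p) U₁ᶜ U₂ᶜ U₃ᶜ := by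
  classical
  rw [sahiE3_compl_sunflower_eq_gladkov_add_sq (prodBernoulli p) MeasurableSet.of_discrete MeasurableSet.of_discrete
    MeasurableSet.of_discrete h12 h13 h23]
  have hG := prodBernoulli_strongHarris_sunflower_three p hU₁ hU₂ hU₃ h12 h13 h23
  linarith

/-- **THE CORE-HEAVY STRATUM.**  If the sunflower is increasing and `μ(U₁)μ(U₂)μ(U₃) ≤ μ(A)²` (the core carries at least the geometric weight of
the members — e.g. every near-diagonal triple), then Kahn's Conjecture 5 holds for its complements: `0 ≤ E_3(U₁ᶜ,U₂ᶜ,U₃ᶜ)`. [this work] -/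
theorem prodBernoulli_sahiE3_compl_sunflower_nonneg_of_coreHeavy (p : ι → unitInterval) {U₁ U₂ U₃ A : Set (Set ι)}
    (hU₁ : IsUpperSet U₁) (hU₂ : IsUpperSet U₂) (hU₃ : IsUpperSet U₃) (h12 : U₁ ∩ U₂ = A) (h13 : U₁ ∩ U₃ = A)
    (h23 : U₂ ∩ U₃ = A)
    (hcore : (prodBernoulli p).real U₁ * (prodBernoulli p).real U₂ * (prodBernoulli p).real U₃ ≤ (prodBernoulli p).real A ^ 2) :
    0 ≤ sahiE3 (prodBernoulli p) U₁ᶜ U₂ᶜ U₃ᶜ := by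
  have h := prodBernoulli_sahiE3_compl_sunflower_ge_sq_sub_prod p hU₁ hU₂ hU₃ h12 h13 h23
  linarith

/-- The same stratum in the generator language of the co-sunflower class: for increasing `F₁, F₂, F₃` with
`μ(F₂F₃)·μ(F₁F₃)·μ(F₁F₂) ≤ μ(F₁F₂F₃)²`, `0 ≤ E_3(μ_p; (F₂F₃)ᶜ, (F₁F₃)ᶜ, (F₁F₂)ᶜ)`. [this work] -/
theorem prodBernoulli_sahiE3_complPairInter_nonneg_of_coreHeavy (p : ι → unitInterval) {F₁ F₂ F₃ : Set (Set ι)}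
    (h₁ : IsUpperSet F₁) (h₂ : IsUpperSet F₂) (h₃ : IsUpperSet F₃)
    (hcore : (prodBernoulli p).real (F₂ ∩ F₃) * (prodBernoulli p).real (F₁ ∩ F₃) * (prodBernoulli p).real (F₁ ∩ F₂) ≤
      (prodBernoulli p).real (F₁ ∩ F₂ ∩ F₃) ^ 2) :
    0 ≤ sahiE3 (prodBernoulli p) (F₂ ∩ F₃)ᶜ (F₁ ∩ F₃)ᶜ (F₁ ∩ F₂)ᶜ := by
  refine prodBernoulli_sahiE3_compl_sunflower_nonneg_of_coreHeavy p (h₂.inter h₃) (h₁.inter h₃) (h₁.inter h₂)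
    (A := F₁ ∩ F₂ ∩ F₃) ?_ ?_ ?_ hcore
  · ext ω; simp only [Set.mem_inter_iff]; tauto
  · ext ω; simp only [Set.mem_inter_iff]; tauto
  · ext ω; simp only [Set.mem_inter_iff]; tauto

end ProdBernoulli

end SahiSunflowerGladkovSquare

end Summit.CriticalPhenomena.PercolationContinuityZ3.Theorems
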